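import Mathlib
import Summits.ValiantsHypothesis.ValiantsHypothesis.Theorems.NewtonTauWeak.Negative.Zonogon
import Summits.ValiantsHypothesis.ValiantsHypothesis.Theorems.NewtonUnitEquationsDissociatedUniformGreedyCharts
import Summits.ValiantsHypothesis.ValiantsHypothesis.Theorems.NewtonUnitEquationsNewtonTauWeakAutomatonDefs
import Summits.ValiantsHypothesis.ValiantsHypothesis.Theorems.NewtonUnitEquationsNewtonTauWeakAutomatonGreedy
import Summits.ValiantsHypothesis.ValiantsHypothesis.Theorems.NewtonUnitEquationsNewtonTauWeakAutomatonStep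
import Summits.ValiantsHypothesis.ValiantsHypothesis.Theorems.NewtonUnitEquationsNewtonTauWeakAutomatonCoeff
import Summits.ValiantsHypothesis.ValiantsHypothesis.Theorems.NewtonUnitEquationsNewtonTauWeakAutomatonRecursion
import Summits.ValiantsHypothesis.ValiantsHypothesis.Theorems.NewtonUnitEquationsNewtonTauWeakAutomatonSupport

/-!
# `NewtonUnitEquationsNewtonTauWeakAutomatonAssembly` — THEOREM A: a K-UNIFORM quasi-polynomial vertex bound on the
# digit hexagon (crux `NewtonTauWeak`, stmt-ValiantsHypothesis-5904; line `binomial-normal-form`, lead c4)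

`hex_digitHexagon_quasiPoly`: for EVERY number `K` of products and every choice of the `3Kn` coefficients,
`vert( Σ_{l<K} c_l Π_{i<n} (1 - a_{li} x^{2^i})(1 - b_{li} y^{2^i})(1 - g_{li} (xy)^{2^i}) ) ≤ 16 · A_K ^ ⌈log₂ n⌉`,
`A_K = 4D³ + 2D² + 2D + 2`, `D = (16K)²` — the first bound of this crux's record that is uniform in the number of
products on a frame WITH coincidences (card `Cruxes/NewtonTauWeak/Lines/binomial-normal-form-automaton.md`).
Proof: carry automaton (`stub_autoCoeff`: the coefficient array is a linear image of the `16K`-dimensional vector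
configuration `hexVecFin`), top survivors are greedy (`stub_autoGreedy`: `vert ≤ 4·|cshadow|`), bilinear
self-similarity (`stub_autoRecursion`) and Theorem Q's product step (`stub_autoStep`) give the shadow recursion
`s(h+m) ≤ 2D²(D s(m) + D s(h) + 1) + 2D + 1`, and halving (`Nat.clog`) closes. [folklore: Theorem Q for tensor trains]
-/

set_option linter.dupNamespace false

noncomputable section

open scoped BigOperators
open MvPolynomial
open Summit.ValiantsHypothesis.ValiantsHypothesis.Theorems.NewtonTauWeak.Negative (vert)
open Summit.ValiantsHypothesis.ValiantsHypothesis.Theorems.NewtonUnitEquationsDissociatedUniform (QuasiPoly.cshadow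
  QuasiPoly.cshadow_subset QuasiPoly.cshadow_finite)

namespace Summit.ValiantsHypothesis.ValiantsHypothesis.Theorems.NewtonTauWeakAutomaton

/-! ## The shadow recursion of the level-`n` configuration (no new definitions: everything inlined) -/

/-- The box `[0,2^n)²` has `2^n · 2^n` points. -/
theorem card_box (n : ℕ) : (box n).card = 2 ^ n * 2 ^ n := by
  simp [box, Finset.card_product]

/-- Trivial bound: the shadow lies in the box. -/
theorem shadow_le_card (K n : ℕ) (a b g : Fin K → ℕ → ℂ) :
    (QuasiPoly.cshadow (box n) (hexVecFin K a b g 0 n) (fun P => ((P.1 : ℕ) : ℝ)) (fun P => ((P.2 : ℕ) : ℝ))).ncard ≤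
      2 ^ n * 2 ^ n := by
  rw [← card_box, ← Set.ncard_coe_finset]
  exact Set.ncard_le_ncard (QuasiPoly.cshadow_subset _ _ _ _) (Finset.finite_toSet _)

/-- The product step specialised to the automaton (`stub_autoStep` + `stub_autoRecursion`):
`s(h+m) ≤ 2D²(D·s_high(m) + D·s_low(h) + 1) + 2D + 1`, `D = (16K)²`. -/
theorem shadow_step (K h m : ℕ) (a b g : Fin K → ℕ → ℂ) :
    (QuasiPoly.cshadow (box (h + m)) (hexVecFin K a b g 0 (h + m)) (fun P => ((P.1 : ℕ) : ℝ))
        (fun P => ((P.2 : ℕ) : ℝ))).ncard ≤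
      2 * (K * 16 * (K * 16) * (K * 16 * (K * 16)) *
          (K * 16 * (K * 16) * (QuasiPoly.cshadow (box m)
              (hexVecFin K (shiftPar a h) (shiftPar b h) (shiftPar g h) 0 m) (fun P => ((P.1 : ℕ) : ℝ))
              (fun P => ((P.2 : ℕ) : ℝ))).ncard +
            K * 16 * (K * 16) * (QuasiPoly.cshadow (box h) (hexVecFin K a b g 0 h) (fun P => ((P.1 : ℕ) : ℝ))
              (fun P => ((P.2 : ℕ) : ℝ))).ncard + 1)) +
        K * 16 * (K * 16) + K * 16 * (K * 16) + 1 := by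
  refine stub_autoStep h m (box (h + m)) (box m) (box h) rfl rfl rfl (hexVecFin K a b g 0 (h + m))
    (hexVecFin K (shiftPar a h) (shiftPar b h) (shiftPar g h) 0 m) (hexVecFin K a b g 0 h) (hexContract K) ?_
  intro H _ L hL
  have hL' : L.1 < 2 ^ h ∧ L.2 < 2 ^ h := by
    simpa [box, Finset.mem_product, Finset.mem_range] using hL
  exact stub_autoRecursion K h m a b g H L hL'

/-- **The shadow recursion, solved by halving**: with `A = 4D³ + 2D² + 2D + 2`, `D = (16K)²`, the level-`n`
configuration has at most `4 · A^{⌈log₂ n⌉}` greedy positions. [folklore] -/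
theorem shadow_bound (K : ℕ) : ∀ n (a b g : Fin K → ℕ → ℂ),
    (QuasiPoly.cshadow (box n) (hexVecFin K a b g 0 n) (fun P => ((P.1 : ℕ) : ℝ)) (fun P => ((P.2 : ℕ) : ℝ))).ncard ≤
      4 * (4 * (K * 16 * (K * 16)) ^ 3 + 2 * (K * 16 * (K * 16)) ^ 2 + 2 * (K * 16 * (K * 16)) + 2) ^
        Nat.clog 2 n := by
  intro n
  induction n using Nat.strong_induction_on with
  | _ n ih =>
    intro a b g
    set D : ℕ := K * 16 * (K * 16) with hD
    set A : ℕ := 4 * D ^ 3 + 2 * D ^ 2 + 2 * D + 2 with hA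
    rcases Nat.lt_or_ge n 2 with hn | hn
    · -- n = 0 or 1: the whole box has ≤ 4 points
      have hclog : Nat.clog 2 n = 0 := Nat.clog_of_right_le_one (by omega) 2
      rw [hclog, pow_zero, mul_one]
      refine (shadow_le_card K n a b g).trans ?_
      interval_cases n <;> norm_num
    · -- split n = h + m with h = n / 2, m = (n + 1) / 2
      set m : ℕ := (n + 1) / 2 with hm
      set h : ℕ := n / 2 with hh
      have hhm : h + m = n := by omega
      have hm_lt : m < n := by omega
      have hh_lt : h < n := by omega
      have hclog : Nat.clog 2 n = Nat.clog 2 m + 1 := by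
        rw [Nat.clog_of_two_le (by norm_num) hn]
        have hm' : (n + 2 - 1) / 2 = m := by omega
        rw [hm']
      have hclog_h : Nat.clog 2 h ≤ Nat.clog 2 m := Nat.clog_mono_right 2 (by omega)
      have ihm := ih m hm_lt (shiftPar a h) (shiftPar b h) (shiftPar g h)
      have ihh := ih h hh_lt a b g
      have step := shadow_step K h m a b g
      rw [hhm] at step
      set c := Nat.clog 2 m with hc
      have hA1 : 1 ≤ A := by rw [hA]; omega
      have hpow : 1 ≤ A ^ c := Nat.one_le_pow _ _ hA1
      have ihh' : (QuasiPoly.cshadow (box h) (hexVecFin K a b g 0 h) (fun P => ((P.1 : ℕ) : ℝ))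
          (fun P => ((P.2 : ℕ) : ℝ))).ncard ≤ 4 * A ^ c :=
        ihh.trans (Nat.mul_le_mul_left _ (Nat.pow_le_pow_right hA1 hclog_h))
      rw [hclog, pow_succ]
      set S := A ^ c with hS
      set sm := (QuasiPoly.cshadow (box m) (hexVecFin K (shiftPar a h) (shiftPar b h) (shiftPar g h) 0 m)
        (fun P => ((P.1 : ℕ) : ℝ)) (fun P => ((P.2 : ℕ) : ℝ))).ncard with hsm
      set sh := (QuasiPoly.cshadow (box h) (hexVecFin K a b g 0 h) (fun P => ((P.1 : ℕ) : ℝ))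
        (fun P => ((P.2 : ℕ) : ℝ))).ncard with hsh
      have e1 : sm ≤ 4 * S := ihm
      have e2 : sh ≤ 4 * S := ihh'
      calc (QuasiPoly.cshadow (box n) (hexVecFin K a b g 0 n) (fun P => ((P.1 : ℕ) : ℝ))
              (fun P => ((P.2 : ℕ) : ℝ))).ncard
          ≤ 2 * (D * D * (D * sm + D * sh + 1)) + D + D + 1 := step
        _ ≤ 2 * (D * D * (D * (4 * S) + D * (4 * S) + 1)) + D + D + 1 := by gcongr
        _ ≤ 4 * S * A := by
            rw [hA]
            nlinarith [hpow, Nat.zero_le D, Nat.zero_le (D * D), Nat.zero_le (D * D * D), Nat.zero_le S]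
        _ = 4 * (S * A) := by ring

/-! ## The coefficient array of the `K`-sum is a linear image of the configuration -/

/-- The top digit: `bitF (2^n t + p) n = t` for `t < 2`, `p < 2^n`. -/
theorem bitF_top (n p : ℕ) (t : Fin 2) (hp : p < 2 ^ n) : bitF (2 ^ n * (t : ℕ) + p) n = t := by
  unfold bitF
  ext
  simp only [Nat.testBit_two_pow_mul_add _ hp, lt_irrefl, if_false, Nat.sub_self]
  have ht : (t : ℕ) < 2 := t.isLt
  interval_cases htv : (t : ℕ)
  · simp [Nat.testBit_zero]
  · simp [Nat.testBit_zero]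

/-- **The coefficient of the `K`-sum at `2^n t + P` is a fixed linear functional (depending on the carry-out `t`)
of the configuration vector at `P`.** [folklore: `stub_autoCoeff`] -/
theorem coeff_hexSum_eq (K n : ℕ) (c : Fin K → ℂ) (a b g : Fin K → ℕ → ℂ) (t : Fin 2 × Fin 2)
    (P : ℕ × ℕ) (hP : P ∈ box n) :
    coeff (Finsupp.single 0 (2 ^ n * (t.1 : ℕ) + P.1) + Finsupp.single 1 (2 ^ n * (t.2 : ℕ) + P.2))
        (hexSum K n c a b g) =
      (∑ l : Fin K, c l • LinearMap.proj (R := ℂ) (φ := fun _ : Fin (K * 16) => ℂ)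
          (idxEquiv K (l, (((0 : Fin 2), (0 : Fin 2)), t)))) (hexVecFin K a b g 0 n P) := by
  have hP' : P.1 < 2 ^ n ∧ P.2 < 2 ^ n := by
    simpa [box, Finset.mem_product, Finset.mem_range] using hP
  have hlt1 : 2 ^ n * (t.1 : ℕ) + P.1 < 2 ^ (n + 1) := by
    have := t.1.isLt; rw [pow_succ]; nlinarith
  have hlt2 : 2 ^ n * (t.2 : ℕ) + P.2 < 2 ^ (n + 1) := by
    have := t.2.isLt; rw [pow_succ]; nlinarith
  unfold hexSum
  rw [coeff_sum, LinearMap.sum_apply]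
  refine Finset.sum_congr rfl fun l _ => ?_
  rw [coeff_C_mul, LinearMap.smul_apply, LinearMap.proj_apply, smul_eq_mul]
  congr 1
  rw [stub_autoCoeff, if_pos ⟨hlt1, hlt2⟩, bitF_top n P.1 t.1 hP'.1, bitF_top n P.2 t.2 hP'.2]
  have hlow := AutoRecursionAux.hexN_low (a l) (b l) (g l) n ((t.1 : ℕ), (t.2 : ℕ)) P hP'
  rw [hlow]
  simp [hexVecFin, hexVec]

/-! ## THEOREM A -/

/-- **THEOREM A (K-uniform quasi-polynomial bound on the digit hexagon).** For EVERY number `K` of products, every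
`n` and all `3Kn + K` coefficients, the Newton polygon of
`hexSum K n c a b g = Σ_{l<K} c_l Π_{i<n} (1 - a_{li} x^{2^i})(1 - b_{li} y^{2^i})(1 - g_{li} (xy)^{2^i})` has at most
`16 · A_K^{⌈log₂ n⌉}` vertices, `A_K = 4D³ + 2D² + 2D + 2`, `D = (16K)²` — i.e. `n^{O(log K)} = K^{O(log n)}`,
uniformly in `K` (T2 predicts `poly(K n)`; before: `2^{O(K log K)}` degree-free, `2(1 + 2(2^n-1))` level bound).
Proof: `stub_autoGreedy` (vertices are greedy positions, `vert ≤ 4·|cshadow|`) with the linear coefficient functionals of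
`coeff_hexSum_eq` and the support bound `stub_autoSupport`, then `shadow_bound`.
[folklore: carry automaton + Theorem Q's greedy-shadow product step ("Theorem Q for tensor trains")] -/
theorem hex_digitHexagon_quasiPoly (K n : ℕ) (c : Fin K → ℂ) (a b g : Fin K → ℕ → ℂ) :
    vert (hexSum K n c a b g) ≤
      16 * (4 * (K * 16 * (K * 16)) ^ 3 + 2 * (K * 16 * (K * 16)) ^ 2 + 2 * (K * 16 * (K * 16)) + 2) ^
        Nat.clog 2 n := by
  have h1 := stub_autoGreedy n (box n) rfl (hexSum K n c a b g) (hexVecFin K a b g 0 n)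
    (fun t => ∑ l : Fin K, c l • LinearMap.proj (R := ℂ) (φ := fun _ : Fin (K * 16) => ℂ)
      (idxEquiv K (l, (((0 : Fin 2), (0 : Fin 2)), t))))
    (stub_autoSupport K n c a b g) (fun t P hP => coeff_hexSum_eq K n c a b g t P hP)
  have h2 := shadow_bound K n a b g
  calc vert (hexSum K n c a b g) ≤ _ := h1
    _ ≤ 4 * (4 * (4 * (K * 16 * (K * 16)) ^ 3 + 2 * (K * 16 * (K * 16)) ^ 2 + 2 * (K * 16 * (K * 16)) + 2) ^
        Nat.clog 2 n) := Nat.mul_le_mul_left 4 h2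
    _ = _ := by ring

end Summit.ValiantsHypothesis.ValiantsHypothesis.Theorems.NewtonTauWeakAutomaton

end
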